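import Summits.Schanuel.Schanuel.Theorems.ZilberEacSimpleZeroBranch
import Mathlib.Algebra.Polynomial.Taylor
import HarnessLib

/-!
# The equimodular class, LIII: the RAMIFIED branches of a fibre curve at infinity — an analytic
# parametrisation `x₀ = s^{-k}`, `y₀ = ψ(s)` through a `k`-fold root of the top row

HONEST FRAMING.  Cell `pub-schanuel` (Zilber's Exponential-Algebraic Closedness, case ladder;
host summit Schanuel), seat 2, gen 25.  The first brick for the class left open by gens 24–25 (top
rows WITHOUT a simple nonzero root: every branch at infinity ramified).  Let `Q = Σ_j q_j(s) t^j` have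
rows of degree `≤ N` (`N ≥ 1`), top row `T = Σ_j [s^N]q_j X^j ≠ 0` and NEXT row
`T₁ = Σ_j [s^{N-1}]q_j X^j`.  **`exists_fibreBranch_ramified`**: if `θ` is a root of `T` (of any
multiplicity) with `T₁(θ) ≠ 0`, then there are `k ≥ 1` — in fact `k = rootMultiplicity θ T` — and
`ψ` analytic at `0` with `ψ(0) = θ`, `ψ ≢ θ`, and `Q(s^{-k}, ψ(s)) = 0` for all small `s ≠ 0`: the
`k`-cycle of Puiseux branches `y₀ = θ + Σ c_i x₀^{-i/k}` at infinity, parametrised analytically.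
Proof: the reversed polynomial `Φ(u, v) = u^N Q(1/u, θ + v)` has lowest row `Φ(u, 0)` with a SIMPLE
zero at `u = 0` (its derivative there is `T₁(θ)`), so the `(1, k)` Newton–Puiseux step of file LI
(`exists_newtonDatum_simpleZero`, which needs no irreducibility) and file XLIX apply with the roles
of the variables as they are: `u = s^k`, `v = s·w(s)`.  For a SIMPLE root `θ` this is gen 24's
`exists_fibreBranch` with `k = 1`.  What is NOT here: the labelled exponential points, the witness
and the phase trichotomy along such a branch (the phases become polynomials in `(τ + 2πik)^{1/k}` —
gen 26).  [folklore (Newton–Puiseux), made concrete]; nothing here is specific to Schanuel's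
conjecture (neither used nor implied); Mantova–Masser's question (PLMS 2024 §1 p. 5) and EC(3,2)
stay OPEN.
-/

noncomputable section

open Filter Topology Polynomial

set_option linter.dupNamespace false

namespace Summit.Schanuel.Schanuel.Theorems

/-- **The ramified branches at infinity through a root `θ` of the top row with `T₁(θ) ≠ 0`.**  See
the module docstring. [folklore (Newton–Puiseux), made concrete] (new in this form) -/
theorem exists_fibreBranch_ramified (Q : ℂ[X][X]) (N : ℕ) (hN1 : 1 ≤ N)
    (hN : ∀ j, (Q.coeff j).natDegree ≤ N) (T T₁ : ℂ[X]) (hT : ∀ j, T.coeff j = (Q.coeff j).coeff N)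
    (hT₁ : ∀ j, T₁.coeff j = (Q.coeff j).coeff (N - 1)) (hT0 : T ≠ 0) {θ : ℂ} (hTθ : T.IsRoot θ)
    (hT₁θ : ¬ T₁.IsRoot θ) :
    ∃ (k : ℕ) (ψ : ℂ → ℂ), 1 ≤ k ∧ k = T.rootMultiplicity θ ∧ AnalyticAt ℂ ψ 0 ∧ ψ 0 = θ ∧
      (¬ ∀ᶠ s in 𝓝 (0 : ℂ), ψ s = θ) ∧
      ∀ᶠ s in 𝓝[≠] (0 : ℂ), (Q.map (Polynomial.evalRingHom (s ^ k)⁻¹)).eval (ψ s) = 0 := by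
  classical
  -- the reversed polynomial `Φ(u, y) = u^N Q(1/u, y)`
  set r := Q.natDegree with hr
  set Φ : ℂ[X][X] := ∑ j ∈ Finset.range (r + 1), Polynomial.monomial j (Polynomial.reflect N (Q.coeff j))
    with hΦ
  have hcoefΦ : ∀ j, Φ.coeff j = if j < r + 1 then Polynomial.reflect N (Q.coeff j) else 0 := by
    intro j
    rw [hΦ, Polynomial.finsetSum_coeff]
    simp only [Polynomial.coeff_monomial, Finset.sum_ite_eq', Finset.mem_range]
  have hΦdeg : Φ.natDegree < r + 1 := by
    refine Nat.lt_succ_of_le (Polynomial.natDegree_sum_le_of_forall_le _ _ fun j hj => ?_)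
    exact (Polynomial.natDegree_monomial_le _).trans (Nat.lt_succ_iff.1 (Finset.mem_range.1 hj))
  have hΦeval : ∀ u : ℂ, u ≠ 0 → ∀ y : ℂ,
      (Φ.map (Polynomial.evalRingHom u)).eval y = u ^ N * (Q.map (Polynomial.evalRingHom u⁻¹)).eval y := by
    intro u hu y
    rw [evalPP_eq_sum Φ u y hΦdeg, evalPP_eq_sum Q _ y (Nat.lt_succ_self _), Finset.mul_sum]
    refine Finset.sum_congr rfl fun j hj => ?_
    rw [hcoefΦ, if_pos (Finset.mem_range.1 hj)]
    haveI := invertibleOfNonzero (inv_ne_zero hu)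
    have h := Polynomial.eval₂_reflect_mul_pow (RingHom.id ℂ) u⁻¹ N (Q.coeff j) (hN j)
    rw [invOf_eq_inv, inv_inv] at h
    change (Polynomial.reflect N (Q.coeff j)).eval u * u⁻¹ ^ N = (Q.coeff j).eval u⁻¹ at h
    rw [← h, show u ^ N * ((Polynomial.reflect N (Q.coeff j)).eval u * u⁻¹ ^ N * y ^ j) =
      (Polynomial.reflect N (Q.coeff j)).eval u * y ^ j * (u * u⁻¹) ^ N by ring, mul_inv_cancel₀ hu, one_pow,
      mul_one]
  -- `Φ(0, ·) = T` and `∂_u Φ(0, ·) = T₁`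
  have hrefl0 : ∀ j, (Polynomial.reflect N (Q.coeff j)).eval 0 = T.coeff j := by
    intro j
    rw [← Polynomial.coeff_zero_eq_eval_zero, Polynomial.coeff_reflect, Polynomial.revAt_zero, hT]
  have hrefl1 : ∀ j, (derivative (Polynomial.reflect N (Q.coeff j))).eval 0 = T₁.coeff j := by
    intro j
    rw [← Polynomial.coeff_zero_eq_eval_zero, Polynomial.coeff_derivative, Polynomial.coeff_reflect,
      Polynomial.revAt_le hN1, hT₁]
    simp
  have hΦ0 : Φ.map (Polynomial.evalRingHom 0) = T := by
    ext j
    rw [Polynomial.coeff_map, hcoefΦ, Polynomial.coe_evalRingHom]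
    split_ifs with hj
    · exact hrefl0 j
    · rw [Polynomial.eval_zero, hT, Polynomial.coeff_eq_zero_of_natDegree_lt (p := Q) (by omega : Q.natDegree < j),
        Polynomial.coeff_zero]
  -- the shifted polynomial `Ψ(u, v) = Φ(u, θ + v)`
  set Ψ : ℂ[X][X] := Φ.comp (Polynomial.X + Polynomial.C (Polynomial.C θ)) with hΨ
  have hΨeval : ∀ u v : ℂ, (Ψ.map (Polynomial.evalRingHom u)).eval v =
      (Φ.map (Polynomial.evalRingHom u)).eval (v + θ) := by
    intro u v
    rw [hΨ, Polynomial.map_comp, Polynomial.eval_comp]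
    simp
  have hΨ0 : Ψ.map (Polynomial.evalRingHom 0) = Polynomial.taylor θ T := by
    rw [hΨ, Polynomial.map_comp, hΦ0, Polynomial.taylor_apply]
    simp
  have hΨcoef0 : ∀ j, (Ψ.coeff j).eval 0 = (Polynomial.taylor θ T).coeff j := by
    intro j
    rw [← hΨ0, Polynomial.coeff_map, Polynomial.coe_evalRingHom]
  -- the lowest row of `Ψ` has a simple zero at `u = 0`
  have hrow0 : (Ψ.coeff 0).IsRoot 0 := by
    rw [Polynomial.IsRoot, hΨcoef0, Polynomial.taylor_coeff_zero]
    exact hTθ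
  have hΨc0 : Ψ.coeff 0 = ∑ j ∈ Finset.range (r + 1),
      Polynomial.reflect N (Q.coeff j) * Polynomial.C θ ^ j := by
    rw [Polynomial.coeff_zero_eq_eval_zero, hΨ, Polynomial.eval_comp, Polynomial.eval_add, Polynomial.eval_X,
      Polynomial.eval_C, zero_add, hΦ, Polynomial.eval_finsetSum]
    simp only [Polynomial.eval_monomial]
  have hrow0' : ¬ (derivative (Ψ.coeff 0)).IsRoot 0 := by
    rw [Polynomial.IsRoot, hΨc0, Polynomial.derivative_sum, Polynomial.eval_finsetSum]
    have key : ∀ j ∈ Finset.range (r + 1),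
        (derivative (Polynomial.reflect N (Q.coeff j) * Polynomial.C θ ^ j)).eval 0 = T₁.coeff j * θ ^ j := by
      intro j _
      rw [Polynomial.derivative_mul, ← Polynomial.C_pow, Polynomial.derivative_C, mul_zero, add_zero,
        Polynomial.eval_mul, Polynomial.eval_C, hrefl1]
    rw [Finset.sum_congr rfl key]
    have hT₁deg : T₁.natDegree < r + 1 := by
      refine Nat.lt_succ_of_le ?_
      rw [Polynomial.natDegree_le_iff_coeff_eq_zero]
      intro j hj
      rw [hT₁, Polynomial.coeff_eq_zero_of_natDegree_lt (p := Q) hj, Polynomial.coeff_zero]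
    rw [← Polynomial.eval_eq_sum_range' hT₁deg]
    exact hT₁θ
  have hex₀ : ∃ j, ¬ (Ψ.coeff j).IsRoot 0 := by
    by_contra hall
    push Not at hall
    apply hT0
    rw [← Polynomial.taylor_eq_zero θ T]
    ext j
    rw [← hΨcoef0, Polynomial.coeff_zero]
    exact hall j
  -- the `(1, k)` Newton–Puiseux step for `Ψ` at `u = 0`
  obtain ⟨k, Qt, w₀, hk1, hw₀, hroot, hsimple, hid, hmin, hk⟩ :=
    exists_newtonDatum_simpleZero Ψ hex₀ hrow0 hrow0'
  obtain ⟨η, hηan, hη0, hηne, hΨη⟩ := exists_newtonBranch Ψ Qt 0 (ν := k) le_rfl hid hw₀ hroot hsimple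
  -- `k` is the multiplicity of `θ`
  have hkmult : k = T.rootMultiplicity θ := by
    rw [Polynomial.rootMultiplicity_eq_natTrailingDegree, ← Polynomial.taylor_apply]
    refine le_antisymm ?_ ?_
    · refine Polynomial.le_natTrailingDegree ((Polynomial.taylor_eq_zero θ T).not.2 hT0) fun m hm => ?_
      rw [← hΨcoef0]
      rcases Nat.eq_zero_or_pos m with h0 | h0
      · rw [h0]; exact hrow0
      · exact hmin m h0 hm
    · refine Polynomial.natTrailingDegree_le_of_ne_zero ?_
      rw [← hΨcoef0]; exact hk
  refine ⟨k, fun s => θ + η s, hk1, hkmult, analyticAt_const.add hηan, by simp [hη0], ?_, ?_⟩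
  · intro h
    apply hηne
    filter_upwards [h] with s hs
    simpa using hs
  · have hηne' : ∀ᶠ s in 𝓝[≠] (0 : ℂ), η s ≠ 0 :=
      hηan.eventually_eq_zero_or_eventually_ne_zero.resolve_left hηne
    filter_upwards [self_mem_nhdsWithin, nhdsWithin_le_nhds hΨη] with s (hs : s ≠ 0) hΨs
    have hsk : s ^ k ≠ 0 := pow_ne_zero _ hs
    rw [zero_add, hΨeval, hΦeval _ hsk, mul_eq_zero] at hΨs
    rcases hΨs with h | h
    · exact absurd h (pow_ne_zero _ hsk)
    · rw [add_comm] at h; exact h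

end Summit.Schanuel.Schanuel.Theorems
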